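import Mathlib

/-!
# Crux `PeriodicWindows` (stmt-AtomisticToContinuum-3240), line `Sketch` — stub `stub_hexClosure`

Step E0b1a of the lead skeleton `PeriodicWindowsSketch` (the hexagon lemma, potential-free
Euclidean geometry in `ℝ³` with horizontal planes `· 2 = const`): in a set `X ⊆ ℝ³` whose
distinct same-height points closer than `1` are at distance exactly `a ∈ [19/20, 1]` and each of
whose points `p` has six same-height points of `X` at distance `a`, every same-height pair
`p, q ∈ X` at distance `a` has both its equilateral completions in `X`.

Proof. Distinct same-height points of `X` are at distance `≥ a`. In the planar complex
coordinate `ζ r = ((r 0 - p 0) + (r 1 - p 1) i)/a` of the level of `p`, distances scale by `a`,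
so the six neighbours of `p` (and `q`) map to unit complex numbers pairwise at distance `≥ 1`.
Planar core: a finite set `T` of unit complex numbers pairwise at distance `≥ 1` has at most six
elements (the six half-open sextants `⌊-3 arg z / π⌋ ∈ {-3, …, 2}` each hold at most one point,
two points of one sextant being at angular distance `< π/3`, i.e. at chord distance `< 1`), so
`q` is one of the six neighbours; and if `T` has six elements and contains `u`, it contains
both hexagon neighbours `u (1/2 ± i√3/2)` of `u` (rotate `u` to `1`; the sextant map is then a
bijection and the point of the sextant `(0, π/3]` is at angular distance `≥ π/3` from `1`, so it
is `e^{iπ/3}`; the other neighbour follows by complex conjugation). Pulling the two neighbours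
of `ζ q` back to `ℝ³` gives the two completions. All `[folklore]`.
-/

noncomputable section

namespace Summit.AtomisticToContinuum.Crystallization.Theorems.PeriodicWindowsSketch

open ComplexConjugate Real

/-! ## Planar core: unit complex numbers pairwise at distance `≥ 1` -/

/-- For unit complex numbers the squared chord is `2 - 2 cos` of the angle difference.
[folklore] -/
theorem norm_sub_sq_of_unit {z w : ℂ} (hz : ‖z‖ = 1) (hw : ‖w‖ = 1) :
    ‖z - w‖ ^ 2 = 2 - 2 * Real.cos (Complex.arg z - Complex.arg w) := by
  have h1 := Complex.norm_mul_cos_arg z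
  have h2 := Complex.norm_mul_sin_arg z
  have h3 := Complex.norm_mul_cos_arg w
  have h4 := Complex.norm_mul_sin_arg w
  rw [hz, one_mul] at h1 h2
  rw [hw, one_mul] at h3 h4
  have h5 := Real.cos_sq_add_sin_sq (Complex.arg z)
  have h6 := Real.cos_sq_add_sin_sq (Complex.arg w)
  rw [Complex.sq_norm, Complex.normSq_apply, Complex.sub_re, Complex.sub_im, Real.cos_sub,
    ← h1, ← h2, ← h3, ← h4]
  linear_combination h5 + h6

/-- Unit complex numbers at angular distance `< π/3` are at chord distance `< 1`. [folklore] -/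
theorem norm_sub_lt_one_of_unit {z w : ℂ} (hz : ‖z‖ = 1) (hw : ‖w‖ = 1)
    (h : |Complex.arg z - Complex.arg w| < π / 3) : ‖z - w‖ < 1 := by
  have hcos : 1 / 2 < Real.cos (Complex.arg z - Complex.arg w) := by
    rw [← Real.cos_abs, ← Real.cos_pi_div_three]
    exact Real.cos_lt_cos_of_nonneg_of_le_pi (abs_nonneg _) (by linarith [Real.pi_pos]) h
  have hsq := norm_sub_sq_of_unit hz hw
  nlinarith [norm_nonneg (z - w)]

/-- Two angles with the same sextant index `⌊-3θ/π⌋` are closer than `π/3`. [folklore] -/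
theorem abs_sub_lt_of_floor_eq {θ φ : ℝ} (h : ⌊-(3 / π) * θ⌋ = ⌊-(3 / π) * φ⌋) :
    |θ - φ| < π / 3 := by
  have hπ := Real.pi_pos
  have h1 := Int.abs_sub_lt_one_of_floor_eq_floor h
  have h3 : π / 3 * (3 / π) = 1 := by field_simp
  have h2 : θ - φ = -(π / 3) * (-(3 / π) * θ - -(3 / π) * φ) := by
    linear_combination (φ - θ) * h3
  rw [h2, abs_mul, abs_neg, abs_of_pos (by positivity : (0 : ℝ) < π / 3)]
  calc π / 3 * |-(3 / π) * θ - -(3 / π) * φ| < π / 3 * 1 := by gcongr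
    _ = π / 3 := mul_one _

/-- The sextant index of an angle in `(-π, π]` lies in `{-3, …, 2}`. [folklore] -/
theorem floor_mem_Icc {θ : ℝ} (h1 : -π < θ) (h2 : θ ≤ π) :
    ⌊-(3 / π) * θ⌋ ∈ Finset.Icc (-3 : ℤ) 2 := by
  have hπ := Real.pi_pos
  have hθ : -(3 / π) * θ = -3 * (θ / π) := by ring
  rw [Finset.mem_Icc, Int.le_floor, Int.floor_le_iff]
  push_cast
  rw [hθ]
  constructor
  · have : θ / π ≤ 1 := by rw [div_le_one hπ]; exact h2
    linarith
  · have : -1 < θ / π := by rw [lt_div_iff₀ hπ]; linarith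
    linarith

/-- The sextant map `z ↦ ⌊-3 arg z / π⌋` sends every complex number into `{-3, …, 2}`.
[folklore] -/
theorem sextant_mapsTo (T : Finset ℂ) :
    Set.MapsTo (fun z : ℂ => ⌊-(3 / π) * Complex.arg z⌋) T (Finset.Icc (-3 : ℤ) 2) :=
  fun z _ => Finset.mem_coe.2 (floor_mem_Icc (Complex.arg_mem_Ioc z).1 (Complex.arg_mem_Ioc z).2)

/-- The sextant map is injective on unit complex numbers pairwise at distance `≥ 1`. [folklore] -/
theorem sextant_injOn {T : Finset ℂ} (h1 : ∀ z ∈ T, ‖z‖ = 1)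
    (h2 : ∀ z ∈ T, ∀ w ∈ T, z ≠ w → 1 ≤ ‖z - w‖) :
    Set.InjOn (fun z : ℂ => ⌊-(3 / π) * Complex.arg z⌋) T := by
  intro z hz w hw hzw
  by_contra hne
  exact (h2 z hz w hw hne).not_gt
    (norm_sub_lt_one_of_unit (h1 z hz) (h1 w hw) (abs_sub_lt_of_floor_eq hzw))

/-- CORE (counting): unit complex numbers pairwise at distance `≥ 1` number at most six.
[folklore] -/
theorem card_le_six_of_unit_sep (T : Finset ℂ) (h1 : ∀ z ∈ T, ‖z‖ = 1)
    (h2 : ∀ z ∈ T, ∀ w ∈ T, z ≠ w → 1 ≤ ‖z - w‖) : T.card ≤ 6 := by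
  have := Finset.card_le_card_of_injOn _ (sextant_mapsTo T) (sextant_injOn h1 h2)
  simpa using this

/-- CORE (hexagon, normalised): six unit complex numbers pairwise at distance `≥ 1`, one of which
is `1`, contain `e^{iπ/3} = 1/2 + i√3/2`. [folklore] -/
theorem hexVertex_mem_of_one_mem (T : Finset ℂ) (h1 : ∀ z ∈ T, ‖z‖ = 1)
    (h2 : ∀ z ∈ T, ∀ w ∈ T, z ≠ w → 1 ≤ ‖z - w‖) (hT : T.card = 6) (h1T : (1 : ℂ) ∈ T) :
    (⟨1 / 2, Real.sqrt 3 / 2⟩ : ℂ) ∈ T := by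
  have hπ := Real.pi_pos
  have hsurj := Finset.surjOn_of_injOn_of_card_le _ (sextant_mapsTo T) (sextant_injOn h1 h2)
    (by simp [hT])
  obtain ⟨z, hz, hfz⟩ := hsurj (show (-1 : ℤ) ∈ ((Finset.Icc (-3 : ℤ) 2 : Finset ℤ) : Set ℤ) by
    simp)
  have hzT : z ∈ T := hz
  simp only at hfz
  rw [Int.floor_eq_iff] at hfz
  push_cast at hfz
  have hθ : -(3 / π) * Complex.arg z = -3 * (Complex.arg z / π) := by ring
  rw [hθ] at hfz
  have hpos : 0 < Complex.arg z := by
    have : 0 < Complex.arg z / π := by linarith [hfz.2]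
    exact (div_pos_iff_of_pos_right hπ).1 this
  have hle : Complex.arg z ≤ π / 3 := by
    have : Complex.arg z / π ≤ 1 / 3 := by linarith [hfz.1]
    rw [div_le_iff₀ hπ] at this
    linarith
  have hz1 : z ≠ 1 := by
    rintro rfl
    simp at hpos
  have hge : π / 3 ≤ Complex.arg z := by
    by_contra hlt
    rw [not_le] at hlt
    have habs : |Complex.arg z - Complex.arg 1| < π / 3 := by
      rw [Complex.arg_one, sub_zero, abs_of_pos hpos]
      exact hlt
    exact (h2 z hzT 1 h1T hz1).not_gt (norm_sub_lt_one_of_unit (h1 z hzT) (h1 1 h1T) habs)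
  have harg : Complex.arg z = π / 3 := le_antisymm hle hge
  have hre := Complex.norm_mul_cos_arg z
  have him := Complex.norm_mul_sin_arg z
  rw [h1 z hzT, one_mul, harg] at hre him
  rw [Real.cos_pi_div_three] at hre
  rw [Real.sin_pi_div_three] at him
  have hzeq : z = ⟨1 / 2, Real.sqrt 3 / 2⟩ := Complex.ext hre.symm him.symm
  exact hzeq ▸ hzT

/-- Isometric images keep unit norms, pairwise distances `≥ 1` and the cardinality. [folklore] -/
theorem image_unit_sep {T : Finset ℂ} (h1 : ∀ z ∈ T, ‖z‖ = 1)
    (h2 : ∀ z ∈ T, ∀ w ∈ T, z ≠ w → 1 ≤ ‖z - w‖) (g : ℂ → ℂ) (hg1 : ∀ z, ‖g z‖ = ‖z‖)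
    (hg2 : ∀ z w, ‖g z - g w‖ = ‖z - w‖) :
    (∀ z ∈ T.image g, ‖z‖ = 1) ∧ (∀ z ∈ T.image g, ∀ w ∈ T.image g, z ≠ w → 1 ≤ ‖z - w‖) ∧
      (T.image g).card = T.card := by
  refine ⟨?_, ?_, ?_⟩
  · intro z hz
    obtain ⟨x, hx, rfl⟩ := Finset.mem_image.1 hz
    rw [hg1]
    exact h1 x hx
  · intro z hz w hw hzw
    obtain ⟨x, hx, rfl⟩ := Finset.mem_image.1 hz
    obtain ⟨y, hy, rfl⟩ := Finset.mem_image.1 hw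
    rw [hg2]
    exact h2 x hx y hy (fun hxy => hzw (by rw [hxy]))
  · apply Finset.card_image_of_injective
    intro x y hxy
    have : ‖x - y‖ = 0 := by rw [← hg2, hxy, sub_self, norm_zero]
    exact sub_eq_zero.1 (norm_eq_zero.1 this)

/-- CORE (hexagon, upper neighbour): six unit complex numbers pairwise at distance `≥ 1` contain,
with each `u`, its hexagon neighbour `u (1/2 + i√3/2)`. [folklore] -/
theorem hexVertex_mul_mem (T : Finset ℂ) (h1 : ∀ z ∈ T, ‖z‖ = 1)
    (h2 : ∀ z ∈ T, ∀ w ∈ T, z ≠ w → 1 ≤ ‖z - w‖) (hT : T.card = 6) {u : ℂ} (hu : u ∈ T) :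
    u * ⟨1 / 2, Real.sqrt 3 / 2⟩ ∈ T := by
  have hu1 : ‖u‖ = 1 := h1 u hu
  have hg1 : ∀ z : ℂ, ‖z * conj u‖ = ‖z‖ := fun z => by
    rw [norm_mul, Complex.norm_conj, hu1, mul_one]
  have hg2 : ∀ z w : ℂ, ‖z * conj u - w * conj u‖ = ‖z - w‖ := fun z w => by
    rw [← sub_mul, norm_mul, Complex.norm_conj, hu1, mul_one]
  obtain ⟨h1', h2', hc⟩ := image_unit_sep h1 h2 (fun z => z * conj u) hg1 hg2
  have huu : u * conj u = 1 := by
    rw [Complex.mul_conj', hu1]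
    simp
  have h1mem : (1 : ℂ) ∈ T.image (fun z => z * conj u) := Finset.mem_image.2 ⟨u, hu, huu⟩
  have hmem := hexVertex_mem_of_one_mem _ h1' h2' (hc.trans hT) h1mem
  obtain ⟨z, hz, hgz⟩ := Finset.mem_image.1 hmem
  have hzeq : z = u * ⟨1 / 2, Real.sqrt 3 / 2⟩ := by
    have hu' : conj u * u = 1 := by rw [mul_comm, huu]
    calc z = z * (conj u * u) := by rw [hu', mul_one]
      _ = z * conj u * u := by ring
      _ = u * ⟨1 / 2, Real.sqrt 3 / 2⟩ := by rw [hgz, mul_comm]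
  exact hzeq ▸ hz

/-- CORE (hexagon): six unit complex numbers pairwise at distance `≥ 1` contain, with each `u`,
both its hexagon neighbours `u (1/2 ± i√3/2)`. [folklore] -/
theorem hex_neighbours_mem (T : Finset ℂ) (h1 : ∀ z ∈ T, ‖z‖ = 1)
    (h2 : ∀ z ∈ T, ∀ w ∈ T, z ≠ w → 1 ≤ ‖z - w‖) (hT : T.card = 6) {u : ℂ} (hu : u ∈ T) :
    u * ⟨1 / 2, Real.sqrt 3 / 2⟩ ∈ T ∧ u * ⟨1 / 2, -(Real.sqrt 3 / 2)⟩ ∈ T := by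
  refine ⟨hexVertex_mul_mem T h1 h2 hT hu, ?_⟩
  obtain ⟨h1', h2', hc⟩ := image_unit_sep h1 h2 (fun z => conj z) (fun z => Complex.norm_conj z)
    (fun z w => by rw [← map_sub, Complex.norm_conj])
  have hu' : conj u ∈ T.image (fun z => conj z) := Finset.mem_image_of_mem _ hu
  have hmem := hexVertex_mul_mem _ h1' h2' (hc.trans hT) hu'
  obtain ⟨z, hz, hgz⟩ := Finset.mem_image.1 hmem
  have hzeq : z = u * ⟨1 / 2, -(Real.sqrt 3 / 2)⟩ := by
    have h := congrArg conj hgz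
    rw [Complex.conj_conj, map_mul, Complex.conj_conj] at h
    rw [h]
    congr 1
  exact hzeq ▸ hz

/-! ## The hexagon lemma in `ℝ³` -/

/-- Planar complex coordinate `ζ r = ((r 0 - p 0) + (r 1 - p 1) i)/a` of same-height points:
distances scale by `a`. [folklore] -/
theorem dist_eq_mul_norm_sub (p r r' : EuclideanSpace ℝ (Fin 3)) {a : ℝ} (ha : 0 < a)
    (hr : r 2 = p 2) (hr' : r' 2 = p 2) :
    dist r r' = a * ‖((⟨(r 0 - p 0) / a, (r 1 - p 1) / a⟩ : ℂ) -
      ⟨(r' 0 - p 0) / a, (r' 1 - p 1) / a⟩)‖ := by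
  rw [← sq_eq_sq₀ dist_nonneg (by positivity), mul_pow, Complex.sq_norm, Complex.normSq_apply,
    Complex.sub_re, Complex.sub_im, EuclideanSpace.dist_sq_eq, Fin.sum_univ_three, Real.dist_eq,
    Real.dist_eq, Real.dist_eq, sq_abs, sq_abs, sq_abs, hr, hr', sub_self]
  field_simp
  ring

/-- STUB E0b1a (the hexagon lemma): in `X ⊆ ℝ³` whose distinct same-height points closer than `1`
are at distance exactly `a ∈ [19/20, 1]` and each of whose points has six same-height points of
`X` at distance `a`, every same-height pair `p, q ∈ X` at distance `a` has both equilateral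
completions `r₁ ≠ r₂` in `X` (same height, at distance `a` from `p` and from `q`). [folklore] -/
theorem stub_hexClosure (X : Set (EuclideanSpace ℝ (Fin 3))) (a : ℝ) (ha1 : 19 / 20 ≤ a)
    (ha2 : a ≤ 1)
    (hsharp : ∀ p ∈ X, ∀ q ∈ X, p ≠ q → dist p q < 1 → q 2 = p 2 → dist p q = a)
    (hsix : ∀ p ∈ X, ∃ F : Finset (EuclideanSpace ℝ (Fin 3)), F.card = 6 ∧
      ∀ q ∈ F, q ∈ X ∧ q 2 = p 2 ∧ dist p q = a) :
    ∀ p ∈ X, ∀ q ∈ X, q 2 = p 2 → dist p q = a →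
      ∃ r₁ ∈ X, ∃ r₂ ∈ X, r₁ ≠ r₂ ∧ r₁ 2 = p 2 ∧ r₂ 2 = p 2 ∧
        dist p r₁ = a ∧ dist q r₁ = a ∧ dist p r₂ = a ∧ dist q r₂ = a := by
  intro p hp q hq hqp hpq
  have ha : 0 < a := by linarith
  -- distinct same-height points of `X` are at distance `≥ a`
  have hsep : ∀ r ∈ X, ∀ r' ∈ X, r ≠ r' → r' 2 = r 2 → a ≤ dist r r' := by
    intro r hr r' hr' hne h2
    by_cases h : dist r r' < 1
    · exact (hsharp r hr r' hr' hne h h2).ge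
    · linarith [not_lt.1 h]
  obtain ⟨F, hF6, hF⟩ := hsix p hp
  -- the planar complex coordinate of the level of `p`
  set ζ : EuclideanSpace ℝ (Fin 3) → ℂ := fun r => ⟨(r 0 - p 0) / a, (r 1 - p 1) / a⟩ with hζ
  have hdist : ∀ r r' : EuclideanSpace ℝ (Fin 3), r 2 = p 2 → r' 2 = p 2 →
      dist r r' = a * ‖ζ r - ζ r'‖ :=
    fun r r' hr hr' => dist_eq_mul_norm_sub p r r' ha hr hr'
  have hζp : ζ p = 0 := by
    simp only [hζ, sub_self, zero_div]
    rfl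
  have hS : ∀ r ∈ insert q F, r ∈ X ∧ r 2 = p 2 ∧ dist p r = a := by
    intro r hr
    rcases Finset.mem_insert.1 hr with rfl | hr
    · exact ⟨hq, hqp, hpq⟩
    · exact hF r hr
  have hT1 : ∀ z ∈ (insert q F).image ζ, ‖z‖ = 1 := by
    intro z hz
    obtain ⟨r, hr, rfl⟩ := Finset.mem_image.1 hz
    obtain ⟨-, hr2, hr3⟩ := hS r hr
    have h := hdist p r rfl hr2
    rw [hζp, zero_sub, norm_neg, hr3] at h
    exact (mul_left_cancel₀ ha.ne' (h.symm.trans (mul_one a).symm))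
  have hT2 : ∀ z ∈ (insert q F).image ζ, ∀ w ∈ (insert q F).image ζ, z ≠ w → 1 ≤ ‖z - w‖ := by
    intro z hz w hw hzw
    obtain ⟨r, hr, rfl⟩ := Finset.mem_image.1 hz
    obtain ⟨r', hr', rfl⟩ := Finset.mem_image.1 hw
    obtain ⟨hrX, hr2, -⟩ := hS r hr
    obtain ⟨hr'X, hr'2, -⟩ := hS r' hr'
    have hne : r ≠ r' := fun h => hzw (by rw [h])
    have h := hsep r hrX r' hr'X hne (hr'2.trans hr2.symm)
    rw [hdist r r' hr2 hr'2] at h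
    nlinarith [norm_nonneg (ζ r - ζ r')]
  have hinj : Set.InjOn ζ ((insert q F : Finset (EuclideanSpace ℝ (Fin 3))) :
      Set (EuclideanSpace ℝ (Fin 3))) := by
    intro r hr r' hr' h
    obtain ⟨-, hr2, -⟩ := hS r (Finset.mem_coe.1 hr)
    obtain ⟨-, hr'2, -⟩ := hS r' (Finset.mem_coe.1 hr')
    have hd := hdist r r' hr2 hr'2
    rw [h, sub_self, norm_zero, mul_zero] at hd
    exact dist_eq_zero.1 hd
  -- seven points are too many: `q` is one of the six neighbours of `p`
  have hqF : q ∈ F := by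
    by_contra hqF
    have hcard : ((insert q F).image ζ).card = 7 := by
      rw [Finset.card_image_of_injOn hinj, Finset.card_insert_of_notMem hqF, hF6]
    have := card_le_six_of_unit_sep _ hT1 hT2
    omega
  have hSF : insert q F = F := Finset.insert_eq_of_mem hqF
  rw [hSF] at hT1 hT2 hinj
  have hcard : (F.image ζ).card = 6 := by rw [Finset.card_image_of_injOn hinj, hF6]
  obtain ⟨hm1, hm2⟩ := hex_neighbours_mem _ hT1 hT2 hcard (Finset.mem_image_of_mem ζ hqF)
  obtain ⟨r₁, hr₁F, hr₁⟩ := Finset.mem_image.1 hm1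
  obtain ⟨r₂, hr₂F, hr₂⟩ := Finset.mem_image.1 hm2
  obtain ⟨hr₁X, hr₁2, hr₁d⟩ := hF r₁ hr₁F
  obtain ⟨hr₂X, hr₂2, hr₂d⟩ := hF r₂ hr₂F
  have hζq : ‖ζ q‖ = 1 := hT1 _ (Finset.mem_image_of_mem ζ hqF)
  have hs3 : Real.sqrt 3 ^ 2 = 3 := Real.sq_sqrt (by norm_num)
  have hn1 : ‖(1 : ℂ) - ⟨1 / 2, Real.sqrt 3 / 2⟩‖ = 1 := by
    rw [← sq_eq_sq₀ (norm_nonneg _) zero_le_one, Complex.sq_norm, Complex.normSq_apply,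
      Complex.sub_re, Complex.sub_im, Complex.one_re, Complex.one_im]
    nlinarith [hs3]
  have hn2 : ‖(1 : ℂ) - ⟨1 / 2, -(Real.sqrt 3 / 2)⟩‖ = 1 := by
    rw [← sq_eq_sq₀ (norm_nonneg _) zero_le_one, Complex.sq_norm, Complex.normSq_apply,
      Complex.sub_re, Complex.sub_im, Complex.one_re, Complex.one_im]
    nlinarith [hs3]
  refine ⟨r₁, hr₁X, r₂, hr₂X, ?_, hr₁2, hr₂2, hr₁d, ?_, hr₂d, ?_⟩
  · intro h
    have hζ12 : ζ r₁ = ζ r₂ := by rw [h]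
    rw [hr₁, hr₂] at hζ12
    have hq0 : ζ q ≠ 0 := by
      intro h0
      rw [h0, norm_zero] at hζq
      exact zero_ne_one hζq
    have him := congrArg Complex.im (mul_left_cancel₀ hq0 hζ12)
    have h3 : 0 < Real.sqrt 3 := Real.sqrt_pos.2 (by norm_num)
    simp only at him
    linarith
  · rw [hdist q r₁ hqp hr₁2, hr₁, ← mul_one_sub, norm_mul, hζq, hn1, mul_one, mul_one]
  · rw [hdist q r₂ hqp hr₂2, hr₂, ← mul_one_sub, norm_mul, hζq, hn2, mul_one, mul_one]

end Summit.AtomisticToContinuum.Crystallization.Theorems.PeriodicWindowsSketch
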